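import Summits.RiemannHypothesis.RiemannHypothesis.Theorems.Splittings.RobinFiniteCakeNum

/-!
# RobinFiniteCakeRowsA — gen 19 «LAYER CAKE AT PT», part 4/10 (D₁): layers 1–7 — the CS 2025 Cor. 1 rows at `σ = 4/5, 33/40, 17/20, 7/8` (hypothesis `hCS`, PREPRINT arXiv:2507.15184) and the FKS 2023 Table 5 rows at `σ = 0.90, 0.91, 0.92` (Literature fact `FioriKadiriSwidinsky2023_table5`, hypothesis `hF5`) absorbed into power rows `A_k·t^{a_k}` and turned into class masses `cakeMass_layer{k}` (certified decimals). RH-free, 0 `def`.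

Cell rh-split, seat rh-split-robin-finite g19 (card `cards/SPLIT-robin-finite.md` §26); carved VERBATIM from
`HOME/rh-split-robin-finite/g19/SketchG19.lean` (sha16 c333eb23d46ea866) by `mk_carve.py`.  Nothing here bears on the truth of RH.

HONEST LABEL: SPLITTING SEARCH over kernel-typed RH-EQUIVALENCES; a splitting A ∧ B ⟹ RH is CONDITIONAL
bookkeeping unless A and B are both proved; nothing here bears on the truth of RH.
-/

set_option linter.dupNamespace false

noncomputable section

open Real Filter Finset
open scoped Chebyshev ComplexConjugate

namespace Summit.RiemannHypothesis.RiemannHypothesis.Theorems.Splittings.RobinFiniteC1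

open Literature.NumberTheory.LFunctions Literature.NumberTheory.DiophantineGeometry
open Literature.NumberTheory.LFunctions.SchoenfeldBound
open Literature.NumberTheory.LFunctions.NicolasJExplicit
open RobinAnalyticSharp
open Literature.NumberTheory.LFunctions.VdC.Num (rpow_le_of_pow_le le_rpow_of_pow_le)
open Summit.RiemannHypothesis.RiemannHypothesis.Theorems.Splittings.RobinFiniteE3
open Summit.RiemannHypothesis.RiemannHypothesis.Theorems.Splittings.RobinFiniteTail
  (zeroTailBound_tailH tailH_PT_le tailH_nonneg)
open Summit.RiemannHypothesis.RiemannHypothesis.Theorems.Splittings.RobinFiniteE1c (summable_tailTerm)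

section CakeRowsA

/-! ### C6 · the fourteen layers: printed row → power `N(σ_k, t) ≤ A_k·t^{a_k}` (`t ≥ 3·10¹²`) → class mass `M_T(u_k) ≤ M̄_k(T)`

Base layers `σ = 4/5, 33/40, 17/20, 7/8`: the Chourasiya–Simonič 2025 row (Cor. 1, `σ ∈ [0.625, 0.875]`, `T ≥ 3·10¹²`:
`N(σ,T) ≤ 21.77·T^{3(1−σ)/(2−σ)}(log T)^{(7−5σ)/(2−σ)} + 8.290·log²T + 147.0·log T`; PREPRINT arXiv:2507.15184v2 p. 3) =
the tree's cite-tagged NAMED FACT `ChourasiyaSimonic2025_cor1` (`Literature/NumberTheory/LFunctions/ZetaZeroDensityIngham1940Explicit`,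
flagged PREPRINT there; Cor. 1
      + Table 1) in HYPOTHESIS position `hCS`, used through its PROVED consequence `.displayed_high`.  Top layers `σ = 0.90, 0.91, …, 0.99`: Fiori–Kadiri–Swidinsky 2023, Thm. 2.7 / Table 5
(J. Math. Anal. Appl. 527 (2023) 127426; rows `(σ, c₁, c₂)`, `T ≥ H₀ = 3·10¹²`), the Literature NAMED FACT
`FioriKadiriSwidinsky2023_table5` in hypothesis position `hF5`.  Absorption of the logarithms: three tangent lines of `log` at
`e·w₁, e·w₂, e·w₃` (`count_le_rpow_of_row3E`). -/

/-- Layer 1 (`σ = 4 / 5`; CS 2025 Cor. 1 row at `σ = 4 / 5`: `p = 1 / 2`, `q = 5 / 2`; tangent points `e·(11.04, 1.262, 0.6307)`,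
`11.04^q ≤ 404.9699`): `N(σ, t) ≤ 8922.2·t^(7 / 12)` for `t ≥ 3·10¹²`.  RH-free. -/
theorem count_layer1 (hCS : ChourasiyaSimonic2025_cor1) :
    ∀ t : ℝ, 3 * (10 : ℝ) ^ 12 ≤ t → (zetaZeroCountRe (1 / 2 + 3 / 10) t : ℝ) ≤ 8922.2 * t ^ (7 / 12 : ℝ) := by
  have hrow : ∀ t : ℝ, 3 * (10 : ℝ) ^ 12 ≤ t → (zetaZeroCountRe (1 / 2 + 3 / 10) t : ℝ) ≤
      21.77 * t ^ (1 / 2 : ℝ) * Real.log t ^ (5 / 2 : ℝ) + 8.290 * Real.log t ^ 2 + 147.0 * Real.log t := by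
    intro t ht
    have h := hCS.displayed_high (σ := 1 / 2 + 3 / 10) (T := t) (by norm_num) (by norm_num) (le_trans (by norm_num [CS2025.H_RH]) ht)
    rw [ingham1940Bound_def] at h
    have e1 : (3 * (1 - (1 / 2 + 3 / 10)) / (2 - (1 / 2 + 3 / 10)) : ℝ) = 1 / 2 := by norm_num
    have e2 : ((7 - 5 * (1 / 2 + 3 / 10)) / (2 - (1 / 2 + 3 / 10)) : ℝ) = 5 / 2 := by norm_num
    rw [e1, e2] at h
    exact h
  have hw : (11.04 : ℝ) ^ (5 / 2 : ℝ) ≤ 404.9699 :=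
    rpow_le_of_pow_le (m := 5) (n := 2) (by norm_num) (by norm_num) (by norm_num) (by norm_num) (by norm_num)
  have habs := count_le_rpow_of_row3E (σ := 1 / 2 + 3 / 10) (c₁ := 21.77) (c₂ := 8.290) (c₃ := 147.0)
    (p := 1 / 2) (q := 5 / 2) (a := 7 / 12) (w₁ := 11.04) (w₂ := 1.262) (w₃ := 0.6307)
    (by norm_num) (by norm_num) (by norm_num) (by norm_num) (by norm_num) (by norm_num) (by norm_num) (by norm_num)
    (le_mul_exp_one_mul (by norm_num) (by norm_num) (by norm_num))
    (le_mul_exp_one_mul (by norm_num) (by norm_num) (by norm_num))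
    (le_mul_exp_one_mul (by norm_num) (by norm_num) (by norm_num)) hrow
  intro t ht
  have ht0 : 0 ≤ t := le_trans (by norm_num) ht
  refine (habs t ht).trans (mul_le_mul_of_nonneg_right ?_ (Real.rpow_nonneg ht0 _))
  have hw0 : (0 : ℝ) ≤ (11.04 : ℝ) ^ (5 / 2 : ℝ) := Real.rpow_nonneg (by norm_num) _
  nlinarith [hw, hw0]

/-- Layer 1: the class mass `M_T(3 / 10) ≤ M̄_1(T) = 4·8922.2·4^(7 / 12)·T^(7 / 12 − 2)/(1 − 4^(7 / 12 − 2))` (`T ≥ 3·10¹²`; RH-free). -/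
theorem cakeMass_layer1 (hCS : ChourasiyaSimonic2025_cor1) {T : ℝ} (hT : 3 * (10 : ℝ) ^ 12 ≤ T) :
    cakeMass T (3 / 10) ≤ (2 * (2 * (8922.2 * (4 : ℝ) ^ (7 / 12 : ℝ) * T ^ ((7 / 12 : ℝ) - 2) / (1 - (4 : ℝ) ^ ((7 / 12 : ℝ) - 2))))) :=
  cakeMass_le_of_densTail (by norm_num) (densTail_le_rpow hT (by norm_num) (by norm_num) (count_layer1 hCS))

/-- Layer 2 (`σ = 33 / 40`; CS 2025 Cor. 1 row at `σ = 33 / 40`: `p = 21 / 47`, `q = 115 / 47`; tangent points `e·(10.41, 1.38, 0.6898)`,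
`10.41^q ≤ 308.6791`): `N(σ, t) ≤ 6837.2·t^(8 / 15)` for `t ≥ 3·10¹²`.  RH-free. -/
theorem count_layer2 (hCS : ChourasiyaSimonic2025_cor1) :
    ∀ t : ℝ, 3 * (10 : ℝ) ^ 12 ≤ t → (zetaZeroCountRe (1 / 2 + 13 / 40) t : ℝ) ≤ 6837.2 * t ^ (8 / 15 : ℝ) := by
  have hrow : ∀ t : ℝ, 3 * (10 : ℝ) ^ 12 ≤ t → (zetaZeroCountRe (1 / 2 + 13 / 40) t : ℝ) ≤
      21.77 * t ^ (21 / 47 : ℝ) * Real.log t ^ (115 / 47 : ℝ) + 8.290 * Real.log t ^ 2 + 147.0 * Real.log t := by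
    intro t ht
    have h := hCS.displayed_high (σ := 1 / 2 + 13 / 40) (T := t) (by norm_num) (by norm_num) (le_trans (by norm_num [CS2025.H_RH]) ht)
    rw [ingham1940Bound_def] at h
    have e1 : (3 * (1 - (1 / 2 + 13 / 40)) / (2 - (1 / 2 + 13 / 40)) : ℝ) = 21 / 47 := by norm_num
    have e2 : ((7 - 5 * (1 / 2 + 13 / 40)) / (2 - (1 / 2 + 13 / 40)) : ℝ) = 115 / 47 := by norm_num
    rw [e1, e2] at h
    exact h
  have hw : (10.41 : ℝ) ^ (115 / 47 : ℝ) ≤ 308.6791 :=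
    rpow_le_of_pow_le (m := 115) (n := 47) (by norm_num) (by norm_num) (by norm_num) (by norm_num) (by norm_num)
  have habs := count_le_rpow_of_row3E (σ := 1 / 2 + 13 / 40) (c₁ := 21.77) (c₂ := 8.290) (c₃ := 147.0)
    (p := 21 / 47) (q := 115 / 47) (a := 8 / 15) (w₁ := 10.41) (w₂ := 1.38) (w₃ := 0.6898)
    (by norm_num) (by norm_num) (by norm_num) (by norm_num) (by norm_num) (by norm_num) (by norm_num) (by norm_num)
    (le_mul_exp_one_mul (by norm_num) (by norm_num) (by norm_num))
    (le_mul_exp_one_mul (by norm_num) (by norm_num) (by norm_num))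
    (le_mul_exp_one_mul (by norm_num) (by norm_num) (by norm_num)) hrow
  intro t ht
  have ht0 : 0 ≤ t := le_trans (by norm_num) ht
  refine (habs t ht).trans (mul_le_mul_of_nonneg_right ?_ (Real.rpow_nonneg ht0 _))
  have hw0 : (0 : ℝ) ≤ (10.41 : ℝ) ^ (115 / 47 : ℝ) := Real.rpow_nonneg (by norm_num) _
  nlinarith [hw, hw0]

/-- Layer 2: the class mass `M_T(13 / 40) ≤ M̄_2(T) = 4·6837.2·4^(8 / 15)·T^(8 / 15 − 2)/(1 − 4^(8 / 15 − 2))` (`T ≥ 3·10¹²`; RH-free). -/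
theorem cakeMass_layer2 (hCS : ChourasiyaSimonic2025_cor1) {T : ℝ} (hT : 3 * (10 : ℝ) ^ 12 ≤ T) :
    cakeMass T (13 / 40) ≤ (2 * (2 * (6837.2 * (4 : ℝ) ^ (8 / 15 : ℝ) * T ^ ((8 / 15 : ℝ) - 2) / (1 - (4 : ℝ) ^ ((8 / 15 : ℝ) - 2))))) :=
  cakeMass_le_of_densTail (by norm_num) (densTail_le_rpow hT (by norm_num) (by norm_num) (count_layer2 hCS))

/-- Layer 3 (`σ = 17 / 20`; CS 2025 Cor. 1 row at `σ = 17 / 20`: `p = 9 / 23`, `q = 55 / 23`; tangent points `e·(11.68, 1.577, 0.7884)`,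
`11.68^q ≤ 356.9281`): `N(σ, t) ≤ 7906.9·t^(7 / 15)` for `t ≥ 3·10¹²`.  RH-free. -/
theorem count_layer3 (hCS : ChourasiyaSimonic2025_cor1) :
    ∀ t : ℝ, 3 * (10 : ℝ) ^ 12 ≤ t → (zetaZeroCountRe (1 / 2 + 7 / 20) t : ℝ) ≤ 7906.9 * t ^ (7 / 15 : ℝ) := by
  have hrow : ∀ t : ℝ, 3 * (10 : ℝ) ^ 12 ≤ t → (zetaZeroCountRe (1 / 2 + 7 / 20) t : ℝ) ≤
      21.77 * t ^ (9 / 23 : ℝ) * Real.log t ^ (55 / 23 : ℝ) + 8.290 * Real.log t ^ 2 + 147.0 * Real.log t := by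
    intro t ht
    have h := hCS.displayed_high (σ := 1 / 2 + 7 / 20) (T := t) (by norm_num) (by norm_num) (le_trans (by norm_num [CS2025.H_RH]) ht)
    rw [ingham1940Bound_def] at h
    have e1 : (3 * (1 - (1 / 2 + 7 / 20)) / (2 - (1 / 2 + 7 / 20)) : ℝ) = 9 / 23 := by norm_num
    have e2 : ((7 - 5 * (1 / 2 + 7 / 20)) / (2 - (1 / 2 + 7 / 20)) : ℝ) = 55 / 23 := by norm_num
    rw [e1, e2] at h
    exact h
  have hw : (11.68 : ℝ) ^ (55 / 23 : ℝ) ≤ 356.9281 :=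
    rpow_le_of_pow_le (m := 55) (n := 23) (by norm_num) (by norm_num) (by norm_num) (by norm_num) (by norm_num)
  have habs := count_le_rpow_of_row3E (σ := 1 / 2 + 7 / 20) (c₁ := 21.77) (c₂ := 8.290) (c₃ := 147.0)
    (p := 9 / 23) (q := 55 / 23) (a := 7 / 15) (w₁ := 11.68) (w₂ := 1.577) (w₃ := 0.7884)
    (by norm_num) (by norm_num) (by norm_num) (by norm_num) (by norm_num) (by norm_num) (by norm_num) (by norm_num)
    (le_mul_exp_one_mul (by norm_num) (by norm_num) (by norm_num))
    (le_mul_exp_one_mul (by norm_num) (by norm_num) (by norm_num))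
    (le_mul_exp_one_mul (by norm_num) (by norm_num) (by norm_num)) hrow
  intro t ht
  have ht0 : 0 ≤ t := le_trans (by norm_num) ht
  refine (habs t ht).trans (mul_le_mul_of_nonneg_right ?_ (Real.rpow_nonneg ht0 _))
  have hw0 : (0 : ℝ) ≤ (11.68 : ℝ) ^ (55 / 23 : ℝ) := Real.rpow_nonneg (by norm_num) _
  nlinarith [hw, hw0]

/-- Layer 3: the class mass `M_T(7 / 20) ≤ M̄_3(T) = 4·7906.9·4^(7 / 15)·T^(7 / 15 − 2)/(1 − 4^(7 / 15 − 2))` (`T ≥ 3·10¹²`; RH-free). -/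
theorem cakeMass_layer3 (hCS : ChourasiyaSimonic2025_cor1) {T : ℝ} (hT : 3 * (10 : ℝ) ^ 12 ≤ T) :
    cakeMass T (7 / 20) ≤ (2 * (2 * (7906.9 * (4 : ℝ) ^ (7 / 15 : ℝ) * T ^ ((7 / 15 : ℝ) - 2) / (1 - (4 : ℝ) ^ ((7 / 15 : ℝ) - 2))))) :=
  cakeMass_le_of_densTail (by norm_num) (densTail_le_rpow hT (by norm_num) (by norm_num) (count_layer3 hCS))

/-- Layer 4 (`σ = 7 / 8`; CS 2025 Cor. 1 row at `σ = 7 / 8`: `p = 1 / 3`, `q = 7 / 3`; tangent points `e·(10.31, 1.766, 0.883)`,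
`10.31^q ≤ 231.3504`): `N(σ, t) ≤ 5192.2·t^(5 / 12)` for `t ≥ 3·10¹²`.  RH-free. -/
theorem count_layer4 (hCS : ChourasiyaSimonic2025_cor1) :
    ∀ t : ℝ, 3 * (10 : ℝ) ^ 12 ≤ t → (zetaZeroCountRe (1 / 2 + 3 / 8) t : ℝ) ≤ 5192.2 * t ^ (5 / 12 : ℝ) := by
  have hrow : ∀ t : ℝ, 3 * (10 : ℝ) ^ 12 ≤ t → (zetaZeroCountRe (1 / 2 + 3 / 8) t : ℝ) ≤
      21.77 * t ^ (1 / 3 : ℝ) * Real.log t ^ (7 / 3 : ℝ) + 8.290 * Real.log t ^ 2 + 147.0 * Real.log t := by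
    intro t ht
    have h := hCS.displayed_high (σ := 1 / 2 + 3 / 8) (T := t) (by norm_num) (by norm_num) (le_trans (by norm_num [CS2025.H_RH]) ht)
    rw [ingham1940Bound_def] at h
    have e1 : (3 * (1 - (1 / 2 + 3 / 8)) / (2 - (1 / 2 + 3 / 8)) : ℝ) = 1 / 3 := by norm_num
    have e2 : ((7 - 5 * (1 / 2 + 3 / 8)) / (2 - (1 / 2 + 3 / 8)) : ℝ) = 7 / 3 := by norm_num
    rw [e1, e2] at h
    exact h
  have hw : (10.31 : ℝ) ^ (7 / 3 : ℝ) ≤ 231.3504 :=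
    rpow_le_of_pow_le (m := 7) (n := 3) (by norm_num) (by norm_num) (by norm_num) (by norm_num) (by norm_num)
  have habs := count_le_rpow_of_row3E (σ := 1 / 2 + 3 / 8) (c₁ := 21.77) (c₂ := 8.290) (c₃ := 147.0)
    (p := 1 / 3) (q := 7 / 3) (a := 5 / 12) (w₁ := 10.31) (w₂ := 1.766) (w₃ := 0.883)
    (by norm_num) (by norm_num) (by norm_num) (by norm_num) (by norm_num) (by norm_num) (by norm_num) (by norm_num)
    (le_mul_exp_one_mul (by norm_num) (by norm_num) (by norm_num))
    (le_mul_exp_one_mul (by norm_num) (by norm_num) (by norm_num))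
    (le_mul_exp_one_mul (by norm_num) (by norm_num) (by norm_num)) hrow
  intro t ht
  have ht0 : 0 ≤ t := le_trans (by norm_num) ht
  refine (habs t ht).trans (mul_le_mul_of_nonneg_right ?_ (Real.rpow_nonneg ht0 _))
  have hw0 : (0 : ℝ) ≤ (10.31 : ℝ) ^ (7 / 3 : ℝ) := Real.rpow_nonneg (by norm_num) _
  nlinarith [hw, hw0]

/-- Layer 4: the class mass `M_T(3 / 8) ≤ M̄_4(T) = 4·5192.2·4^(5 / 12)·T^(5 / 12 − 2)/(1 − 4^(5 / 12 − 2))` (`T ≥ 3·10¹²`; RH-free). -/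
theorem cakeMass_layer4 (hCS : ChourasiyaSimonic2025_cor1) {T : ℝ} (hT : 3 * (10 : ℝ) ^ 12 ≤ T) :
    cakeMass T (3 / 8) ≤ (2 * (2 * (5192.2 * (4 : ℝ) ^ (5 / 12 : ℝ) * T ^ ((5 / 12 : ℝ) - 2) / (1 - (4 : ℝ) ^ ((5 / 12 : ℝ) - 2))))) :=
  cakeMass_le_of_densTail (by norm_num) (densTail_le_rpow hT (by norm_num) (by norm_num) (count_layer4 hCS))

/-- Layer 5 (`σ = 0.900`; FKS 2023 Table 5 row `(0.900, 12.0272, 2.8891)`: `p = 4 / 15`, `q = 16 / 5`; tangent points `e·(10.87, 1.963, 0.9811)`,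
`10.87^q ≤ 2069.83`): `N(σ, t) ≤ 24906·t^(3 / 8)` for `t ≥ 3·10¹²`.  RH-free. -/
theorem count_layer5 (hF5 : FioriKadiriSwidinsky2023_table5) :
    ∀ t : ℝ, 3 * (10 : ℝ) ^ 12 ≤ t → (zetaZeroCountRe (1 / 2 + 2 / 5) t : ℝ) ≤ 24906 * t ^ (3 / 8 : ℝ) := by
  have hrow : ∀ t : ℝ, 3 * (10 : ℝ) ^ 12 ≤ t → (zetaZeroCountRe (1 / 2 + 2 / 5) t : ℝ) ≤
      12.0272 * t ^ (4 / 15 : ℝ) * Real.log t ^ (16 / 5 : ℝ) + 2.8891 * Real.log t ^ 2 + 0 * Real.log t := by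
    intro t ht
    have h := FioriKadiriSwidinsky2023_table5.of_le hF5 (σ := 0.900) (c₁ := 12.0272) (c₂ := 2.8891)
      (by simp [FKS2023.table5]) (σ' := 1 / 2 + 2 / 5) (T := t) (by norm_num) (by exact ht)
    rw [inghamBound_def] at h
    have e1 : (8 / 3 * (1 - 0.900) : ℝ) = 4 / 15 := by norm_num
    have e2 : (5 - 2 * 0.900 : ℝ) = 16 / 5 := by norm_num
    rw [e1, e2] at h
    linarith
  have hw : (10.87 : ℝ) ^ (16 / 5 : ℝ) ≤ 2069.83 :=
    rpow_le_of_pow_le (m := 16) (n := 5) (by norm_num) (by norm_num) (by norm_num) (by norm_num) (by norm_num)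
  have habs := count_le_rpow_of_row3E (σ := 1 / 2 + 2 / 5) (c₁ := 12.0272) (c₂ := 2.8891) (c₃ := 0)
    (p := 4 / 15) (q := 16 / 5) (a := 3 / 8) (w₁ := 10.87) (w₂ := 1.963) (w₃ := 0.9811)
    (by norm_num) (by norm_num) (by norm_num) (by norm_num) (by norm_num) (by norm_num) (by norm_num) (by norm_num)
    (le_mul_exp_one_mul (by norm_num) (by norm_num) (by norm_num))
    (le_mul_exp_one_mul (by norm_num) (by norm_num) (by norm_num))
    (le_mul_exp_one_mul (by norm_num) (by norm_num) (by norm_num)) hrow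
  intro t ht
  have ht0 : 0 ≤ t := le_trans (by norm_num) ht
  refine (habs t ht).trans (mul_le_mul_of_nonneg_right ?_ (Real.rpow_nonneg ht0 _))
  have hw0 : (0 : ℝ) ≤ (10.87 : ℝ) ^ (16 / 5 : ℝ) := Real.rpow_nonneg (by norm_num) _
  nlinarith [hw, hw0]

/-- Layer 5: the class mass `M_T(2 / 5) ≤ M̄_5(T) = 4·24906·4^(3 / 8)·T^(3 / 8 − 2)/(1 − 4^(3 / 8 − 2))` (`T ≥ 3·10¹²`; RH-free). -/
theorem cakeMass_layer5 (hF5 : FioriKadiriSwidinsky2023_table5) {T : ℝ} (hT : 3 * (10 : ℝ) ^ 12 ≤ T) :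
    cakeMass T (2 / 5) ≤ (2 * (2 * (24906 * (4 : ℝ) ^ (3 / 8 : ℝ) * T ^ ((3 / 8 : ℝ) - 2) / (1 - (4 : ℝ) ^ ((3 / 8 : ℝ) - 2))))) :=
  cakeMass_le_of_densTail (by norm_num) (densTail_le_rpow hT (by norm_num) (by norm_num) (count_layer5 hF5))

/-- Layer 6 (`σ = 0.910`; FKS 2023 Table 5 row `(0.910, 12.5219, 2.8088)`: `p = 6 / 25`, `q = 159 / 50`; tangent points `e·(9.987, 2.061, 1.031)`,
`9.987^q ≤ 1507.314`): `N(σ, t) ≤ 18887·t^(5 / 14)` for `t ≥ 3·10¹²`.  RH-free. -/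
theorem count_layer6 (hF5 : FioriKadiriSwidinsky2023_table5) :
    ∀ t : ℝ, 3 * (10 : ℝ) ^ 12 ≤ t → (zetaZeroCountRe (1 / 2 + 41 / 100) t : ℝ) ≤ 18887 * t ^ (5 / 14 : ℝ) := by
  have hrow : ∀ t : ℝ, 3 * (10 : ℝ) ^ 12 ≤ t → (zetaZeroCountRe (1 / 2 + 41 / 100) t : ℝ) ≤
      12.5219 * t ^ (6 / 25 : ℝ) * Real.log t ^ (159 / 50 : ℝ) + 2.8088 * Real.log t ^ 2 + 0 * Real.log t := by
    intro t ht
    have h := FioriKadiriSwidinsky2023_table5.of_le hF5 (σ := 0.910) (c₁ := 12.5219) (c₂ := 2.8088)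
      (by simp [FKS2023.table5]) (σ' := 1 / 2 + 41 / 100) (T := t) (by norm_num) (by exact ht)
    rw [inghamBound_def] at h
    have e1 : (8 / 3 * (1 - 0.910) : ℝ) = 6 / 25 := by norm_num
    have e2 : (5 - 2 * 0.910 : ℝ) = 159 / 50 := by norm_num
    rw [e1, e2] at h
    linarith
  have hw : (9.987 : ℝ) ^ (159 / 50 : ℝ) ≤ 1507.314 :=
    rpow_le_of_pow_le (m := 159) (n := 50) (by norm_num) (by norm_num) (by norm_num) (by norm_num) (by norm_num)
  have habs := count_le_rpow_of_row3E (σ := 1 / 2 + 41 / 100) (c₁ := 12.5219) (c₂ := 2.8088) (c₃ := 0)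
    (p := 6 / 25) (q := 159 / 50) (a := 5 / 14) (w₁ := 9.987) (w₂ := 2.061) (w₃ := 1.031)
    (by norm_num) (by norm_num) (by norm_num) (by norm_num) (by norm_num) (by norm_num) (by norm_num) (by norm_num)
    (le_mul_exp_one_mul (by norm_num) (by norm_num) (by norm_num))
    (le_mul_exp_one_mul (by norm_num) (by norm_num) (by norm_num))
    (le_mul_exp_one_mul (by norm_num) (by norm_num) (by norm_num)) hrow
  intro t ht
  have ht0 : 0 ≤ t := le_trans (by norm_num) ht
  refine (habs t ht).trans (mul_le_mul_of_nonneg_right ?_ (Real.rpow_nonneg ht0 _))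
  have hw0 : (0 : ℝ) ≤ (9.987 : ℝ) ^ (159 / 50 : ℝ) := Real.rpow_nonneg (by norm_num) _
  nlinarith [hw, hw0]

/-- Layer 6: the class mass `M_T(41 / 100) ≤ M̄_6(T) = 4·18887·4^(5 / 14)·T^(5 / 14 − 2)/(1 − 4^(5 / 14 − 2))` (`T ≥ 3·10¹²`; RH-free). -/
theorem cakeMass_layer6 (hF5 : FioriKadiriSwidinsky2023_table5) {T : ℝ} (hT : 3 * (10 : ℝ) ^ 12 ≤ T) :
    cakeMass T (41 / 100) ≤ (2 * (2 * (18887 * (4 : ℝ) ^ (5 / 14 : ℝ) * T ^ ((5 / 14 : ℝ) - 2) / (1 - (4 : ℝ) ^ ((5 / 14 : ℝ) - 2))))) :=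
  cakeMass_le_of_densTail (by norm_num) (densTail_le_rpow hT (by norm_num) (by norm_num) (count_layer6 hF5))

/-- Layer 7 (`σ = 0.920`; FKS 2023 Table 5 row `(0.920, 13.0286, 2.7285)`: `p = 16 / 75`, `q = 79 / 25`; tangent points `e·(12.32, 2.392, 1.196)`,
`12.32^q ≤ 2794.666`): `N(σ, t) ≤ 36427·t^(4 / 13)` for `t ≥ 3·10¹²`.  RH-free. -/
theorem count_layer7 (hF5 : FioriKadiriSwidinsky2023_table5) :
    ∀ t : ℝ, 3 * (10 : ℝ) ^ 12 ≤ t → (zetaZeroCountRe (1 / 2 + 21 / 50) t : ℝ) ≤ 36427 * t ^ (4 / 13 : ℝ) := by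
  have hrow : ∀ t : ℝ, 3 * (10 : ℝ) ^ 12 ≤ t → (zetaZeroCountRe (1 / 2 + 21 / 50) t : ℝ) ≤
      13.0286 * t ^ (16 / 75 : ℝ) * Real.log t ^ (79 / 25 : ℝ) + 2.7285 * Real.log t ^ 2 + 0 * Real.log t := by
    intro t ht
    have h := FioriKadiriSwidinsky2023_table5.of_le hF5 (σ := 0.920) (c₁ := 13.0286) (c₂ := 2.7285)
      (by simp [FKS2023.table5]) (σ' := 1 / 2 + 21 / 50) (T := t) (by norm_num) (by exact ht)
    rw [inghamBound_def] at h
    have e1 : (8 / 3 * (1 - 0.920) : ℝ) = 16 / 75 := by norm_num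
    have e2 : (5 - 2 * 0.920 : ℝ) = 79 / 25 := by norm_num
    rw [e1, e2] at h
    linarith
  have hw : (12.32 : ℝ) ^ (79 / 25 : ℝ) ≤ 2794.666 :=
    rpow_le_of_pow_le (m := 79) (n := 25) (by norm_num) (by norm_num) (by norm_num) (by norm_num) (by norm_num)
  have habs := count_le_rpow_of_row3E (σ := 1 / 2 + 21 / 50) (c₁ := 13.0286) (c₂ := 2.7285) (c₃ := 0)
    (p := 16 / 75) (q := 79 / 25) (a := 4 / 13) (w₁ := 12.32) (w₂ := 2.392) (w₃ := 1.196)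
    (by norm_num) (by norm_num) (by norm_num) (by norm_num) (by norm_num) (by norm_num) (by norm_num) (by norm_num)
    (le_mul_exp_one_mul (by norm_num) (by norm_num) (by norm_num))
    (le_mul_exp_one_mul (by norm_num) (by norm_num) (by norm_num))
    (le_mul_exp_one_mul (by norm_num) (by norm_num) (by norm_num)) hrow
  intro t ht
  have ht0 : 0 ≤ t := le_trans (by norm_num) ht
  refine (habs t ht).trans (mul_le_mul_of_nonneg_right ?_ (Real.rpow_nonneg ht0 _))
  have hw0 : (0 : ℝ) ≤ (12.32 : ℝ) ^ (79 / 25 : ℝ) := Real.rpow_nonneg (by norm_num) _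
  nlinarith [hw, hw0]

/-- Layer 7: the class mass `M_T(21 / 50) ≤ M̄_7(T) = 4·36427·4^(4 / 13)·T^(4 / 13 − 2)/(1 − 4^(4 / 13 − 2))` (`T ≥ 3·10¹²`; RH-free). -/
theorem cakeMass_layer7 (hF5 : FioriKadiriSwidinsky2023_table5) {T : ℝ} (hT : 3 * (10 : ℝ) ^ 12 ≤ T) :
    cakeMass T (21 / 50) ≤ (2 * (2 * (36427 * (4 : ℝ) ^ (4 / 13 : ℝ) * T ^ ((4 / 13 : ℝ) - 2) / (1 - (4 : ℝ) ^ ((4 / 13 : ℝ) - 2))))) :=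
  cakeMass_le_of_densTail (by norm_num) (densTail_le_rpow hT (by norm_num) (by norm_num) (count_layer7 hF5))

end CakeRowsA

end Summit.RiemannHypothesis.RiemannHypothesis.Theorems.Splittings.RobinFiniteC1

end
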